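import Literature.MathematicalPhysics.QuantumFieldTheory.Balaban1983to89.T4RecordPriceSeam

/-!
# `Balaban1983to89.T4PartnerMultiplicity` — the WINDOW SURPLUS of a merged genealogy pays the partner multiplicity
`Λ′^{partner ages}` at NO change of the rate condition; the count member's chain re-seamed through a
MULTIPLICITY-TOLERANT labelling binder (cell `pub-balaban`, T4-DAG §5 self-row T4-U5c.E-NE7b-MULT-K* (§8 Q24(a)), node
U5c / U5.E, spine estimate NE7b, COUNT member P1 «Peierls / entropy–energy counting of persistent large-field histories»,
gen 12; record `t4/T4-EST-NE7b-P1.md` v1.12; kernel bookkeeping — finite combinatorics + real arithmetic; imports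
`T4RecordPriceSeam` (this lineage, v1 p191299) and, through it, `T4LiveGasToTerms` (renewal member t4-ne7b-p2, v1.1)
BY NAME and modifies nothing.  VERSION v1 = this file.)

HONEST FRAMING (T4-DAG PAGE 1).  The cell's T4 target is the existence and uniqueness of the `ε → 0` limit of unit-scale
block-averaged expectations on a FIXED finite torus, at rung (B)+1, CONDITIONAL on Bałaban's ultraviolet stability (B)
and on BetaPertH; it is NOT infinite volume, NOT the mass gap, NOT the Clay problem.  This module is [folklore] finite
combinatorics and real analysis.  NOTHING of Bałaban's is asserted or quoted: no sentence of [Balaban1989LargeFieldII]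
(cell paper B16, CMP 122 (1989) 355–392) or of [Balaban1988Convergent] (B14, CMP 119 (1988) 243–285) is a hypothesis of
anything here.  (B), BetaPertH, (B^μ), the reading (ID) and the model's residual budgets are DISPLAYED BINDERS of the
theorems below, exactly as in `T4RecordPriceSeam` — none is hidden in a definition.  Value = a kernel certificate about
OUR OWN counting chain; NOT an estimate of Bałaban's expansion; NOT summit progress; NOT a proof of NE7b.

THE LOCATED POINT (count side; the §4 REMARK of `T4RecordPriceSeam` and item (e) of its cross-read C-pv23g10-2, made
quantitative).  In the seam's end-to-end statement `T4RecordPriceSeam.exists_irThreshold_relWeightBound` the price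
`y K j z b Q` of a live slot (birth step `j`, birth CELL `z`, birth event `b`, record `Q`) must be LABELLED (binder `hlab`)
by ONE consistent well-formed genealogy `G` with `y ≤ e^{−credits G}·e^{+lifeCost G}`.  A slot records the root's cell
and the (step, kind, class) of every event — but NOT the birth cells of the PARTNERS merged into the structure: a
partner born at step `s′` and merged at step `m` may sit in any of `≍ Λ^{m − s′}` cells of its birth lattice compatible
with the merger (times a bounded attachment factor), so the realised price of the slot is a SUM over these placements
and exceeds one genealogy's raw factor by a MULTIPLICITY growing like `Λ′^{Σ_mergers (m + 1 − s′)}`.  As typed, `hlab`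
cannot absorb it; re-scaling `κ₁ ↦ κ₁ − log Λ′` would, at the price of the rate condition `Λ·Λ′·e^{η̄−κ₁} < 1`, i.e. of
DOUBLING the position-entropy threshold of NE7b.  THIS MODULE shows the threshold need not move:
  §1 THE WINDOW SURPLUS.  For a well-formed genealogy the event windows add up to MORE than the life span:
     `Σ_{e ∈ events G} W e = (reach G − rootStep G) + windowSurplus W G` (`sum_windows_eq`), where the surplus collects,
     per merger, the steps on which BOTH partners were pending (`min reach − max rootStep`) and, per renewal, the lag
     `reach − (h+1)` (zero at readiness).  For a CONSISTENT genealogy of the dictionary each merger term is at least the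
     later partner's age at the merger plus one: `partnerAges ≤ windowSurplus` (`partnerAges_le_windowSurplus`), hence,
     pending at `K`, `(K + 1 − rootStep) + partnerAges G ≤ Σ_{events} W` (`span_add_partnerAges_le`).  The records count of
     `T4PersistentHistoryCount` (`pairedFactor_le`) used ONLY `K + 1 − j ≤ Σ W` and DISCARDED the surplus.
  §2 THE TELESCOPED SHAPE.  The count needs of a record price only `y Q ≤ ρ b · e^{−κ₁ (K + 1 − j)} · ∏_{e ∈ Q} η e`
     (`telescopedRecordSum_le`, `slotPriceT_le`: the same `ρ̄ e^{−κ₁} σ^{K − j}` per slot as `slotPrice_le`, proof = its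
     second half).  A price in the seam's record shape TIMES `Λ′^D` is telescoped as soon as `(K + 1 − j) + D ≤ W b + Σ_Q W`
     and `Λ′·e^{−κ₁} ≤ 1` (`mulFactor_le`, `telescoped_of_mulRecordShape`; `D = 0`, `Λ′ = 1` is the seam's case,
     `telescoped_of_recordShape`): every surplus step carries an unused credit `e^{−κ₁} ≤ 1/Λ′`.
  §3 MASSES FROM ANY PER-SLOT BOUND.  `liveMass_le_of_slotBound` / `oldMass_le_of_slotBound`: the live mass
     `≤ C·V/(1 − Λσ)` and the old mass `≤ C·V·(Λσ)^{K − j⋆ + 1}/(1 − Λσ)` from ANY bound `Σ_b Σ_Q y j z b Q ≤ C σ^{K − j}`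
     (the cell sums of `T4LiveStructureGas.liveMass_le` / `T4PersistentHistoryCount.slotBudget_model`, abstracted so that a
     future branching count can feed them too).
  §4 COMPOSITION BY NAME.  `exists_relWeightBound_of_regeneration_telescopedGasRun`: the renewal member's ABSTRACT
     `T4LiveGasToTerms.exists_relWeightBound_of_regeneration_liveGas` over the typed live slots with run-indexed windows,
     prices in the TELESCOPED shape from `K₀` on, budgets `ρ̄`, `η̄`, rate `Λ·e^{η̄−κ₁} < 1` ⇒ `∃ K₁ ≥ K₀, RelWeightBound`
     with the SAME `recordsBudget ρ̄ κ₁ V Λ η̄ j⋆` as the seam.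
  §5 THE MULTIPLICITY-TOLERANT SEAM.  `partnerAges_le_windowSurplus` (consistency places each merger in
     `[max rootStep, min reach)`), `span_add_partnerAges_le`; `telescoped_of_labelM`: under `Banking` at cutoff `K`, a
     price with `y ≤ 0 ∨ ∃ G consistent, well formed, rootStep G = j, K < reach G, root G = b, (events G).erase root = Q,
     y ≤ Λ′^{partnerAges G} · e^{−credits G} · e^{+lifeCost G}` (the binder `hlabM`; `0 ≤ Λ′`, `Λ′ e^{−κ₁} ≤ 1`) is
     telescoped (`price_le_shape` of the seam + §1 + §2); `telescopedShape_of_bankingM` = the same per cutoff.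
  §6 END TO END.  `exists_relWeightBound_of_bankingM` and `exists_irThreshold_relWeightBoundM` = the seam's §3
     statements VERBATIM with `hlab` replaced by `hlabM` and the two `Λ′` binders added — same flow hypotheses, same
     budgets, same rate `Λ·e^{η̄ − C.κ₁} < 1`, same conclusion.  So a partner-position multiplicity `Λ′^{partnerAges}`
     with `Λ′ ≤ e^{κ₁}` costs NOTHING in the threshold: each partner pays the entropy of its own birth cell out of the
     window credit of its own pendency, exactly as the root does through `Λσ < 1`.
  §7 SANITY (decided / by `simp` / `norm_num`): on the cross-read's merged genealogy `Z₀ = merge X₀ Y₀ (3,2,0)` (partners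
     born at 0 and 2, merged at step 3, windows 4, 4, 3): `partnerAges = 2`, `windowSurplus = 2`, `Σ W = 11 = (9 − 0) + 2`;
     `Z₀` is consistent at cutoff `8 < 9 = reach`, so the labelled branch of `hlabM` is inhabited on a merged, pending
     history (with `Λ′ = 1` and the raw factor as price); `mulFactor_le` at numbers and its TIGHTNESS (one factor `Λ′`
     more than surplus steps is not paid).
WHAT THIS DOES NOT DO.  (i) It does not discharge `hlabM`: that the realised price of a slot is at most
`Λ′^{partnerAges}` (times factors absorbed in `ρ`, `η`) times the raw factor of its genealogy is the READING (ID) plus a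
GEOMETRIC multiplicity statement about Bałaban's regions on the block lattices of T⁴ (attachment sites, region sizes
under coarse-graining) that this chain has never typed — it stays a displayed binder (GAPS G-ne7bp1g9-1, owner O-R10, and
the new located row of this generation).  (ii) It does not make the residual budgets `hρbar`/`hηbar` `K`-uniform for
histories with simultaneous same-class events in parallel branches (distinct labels forced by `Gen.WF`): with flat
set-valued records that needs either class-disambiguated labels with summable weights or a branching (tree-valued)
record; the abstract §3/§4 are shaped to receive such a count, nothing more.  (iii) It does not touch the typed flow, the
infrared smallness, `Regeneration`, the domination `hF`, (G2)/(G5), or any module of another seat.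

References (locators only, nothing quoted): [Balaban1989LargeFieldII] (1.79) p. 383, (1.82) p. 385, (1.84)–(1.89)
pp. 385–388; [Balaban1988Convergent] (2.5), (2.7) p. 255, (2.9) p. 256 — as typed in `B14` / `B14FlowStep` and read in
`T4PrintedShapeBanking` / `T4PersistenceDictionary` / `T4LiveStructureGas` / `T4RecordPriceSeam`.
-/

open Finset

namespace Literature.MathematicalPhysics.QuantumFieldTheory.Balaban1983to89.T4PartnerMultiplicity

open Literature.MathematicalPhysics.QuantumFieldTheory.Balaban1983to89
open T4PersistenceDictionary T4PersistentHistoryCount T4BankedInduction T4PrintedShapeBanking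
open T4WeightBudget T4GlobalDenominator T4LiveClassFibration T4LiveStructureGas T4LiveGasToTerms T4RecordPriceSeam

/-! ## §1 The window surplus of a genealogy -/

section Surplus

variable {ε : Type*}

/-- **THE WINDOW SURPLUS** of a genealogy: per renewal at readiness step `h`, the lag `reach − (h + 1)` (zero in print,
where renewal happens AT readiness); per merger, the number of steps `min (reach X) (reach Y) − max (rootStep X)
(rootStep Y)` on which BOTH partners were pending — steps covered twice by the placed windows. [folklore] -/
def windowSurplus (W : ε → ℕ) : Gen ε → ℕ
  | Gen.born _ _ => 0
  | Gen.renew G _ h => windowSurplus W G + (G.reach W - (h + 1))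
  | Gen.merge X Y _ => windowSurplus W X + windowSurplus W Y +
      (min (X.reach W) (Y.reach W) - max X.rootStep Y.rootStep)

/-- **THE PARTNER AGES** of a genealogy over events with a step `st`: per merger by the event `e`, the age of the LATER-born
partner at the merger step plus one, `st e + 1 − max (rootStep X) (rootStep Y)` — the exponent of the partner-position
multiplicity (the later partner's birth cell is one of `≍ Λ^{age}` cells under the merger block). [folklore] -/
def partnerAges (st : ε → ℕ) : Gen ε → ℕ
  | Gen.born _ _ => 0
  | Gen.renew G _ _ => partnerAges st G
  | Gen.merge X Y e => partnerAges st X + partnerAges st Y + (st e + 1 - max X.rootStep Y.rootStep)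

/-- surplus of a bare birth [folklore] -/
@[simp] theorem windowSurplus_born (W : ε → ℕ) (b : ε) (j : ℕ) : windowSurplus W (Gen.born b j) = 0 := rfl
/-- surplus after a renewal [folklore] -/
@[simp] theorem windowSurplus_renew (W : ε → ℕ) (G : Gen ε) (e : ε) (h : ℕ) :
    windowSurplus W (Gen.renew G e h) = windowSurplus W G + (G.reach W - (h + 1)) := rfl
/-- surplus after a merger [folklore] -/
@[simp] theorem windowSurplus_merge (W : ε → ℕ) (X Y : Gen ε) (e : ε) :
    windowSurplus W (Gen.merge X Y e) = windowSurplus W X + windowSurplus W Y +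
      (min (X.reach W) (Y.reach W) - max X.rootStep Y.rootStep) := rfl
/-- partner ages of a bare birth [folklore] -/
@[simp] theorem partnerAges_born (st : ε → ℕ) (b : ε) (j : ℕ) : partnerAges st (Gen.born b j) = 0 := rfl
/-- partner ages after a renewal [folklore] -/
@[simp] theorem partnerAges_renew (st : ε → ℕ) (G : Gen ε) (e : ε) (h : ℕ) :
    partnerAges st (Gen.renew G e h) = partnerAges st G := rfl
/-- partner ages after a merger [folklore] -/
@[simp] theorem partnerAges_merge (st : ε → ℕ) (X Y : Gen ε) (e : ε) :
    partnerAges st (Gen.merge X Y e) = partnerAges st X + partnerAges st Y + (st e + 1 - max X.rootStep Y.rootStep) :=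
  rfl

variable [DecidableEq ε]

/-- A well-formed genealogy is born no later than its reach. [folklore] -/
theorem rootStep_le_reach_of_wf (W : ε → ℕ) : ∀ {G : Gen ε}, G.WF W → G.rootStep ≤ G.reach W
  | Gen.born b j, _ => by simp
  | Gen.renew G e h, hW => by
      simp only [Gen.WF] at hW
      obtain ⟨-, -, hr, -⟩ := hW
      simp only [Gen.rootStep_renew, Gen.reach_renew]
      omega
  | Gen.merge X Y e, hW => by
      simp only [Gen.WF] at hW
      obtain ⟨hX, -, -, -, -, -, -⟩ := hW
      have h := rootStep_le_reach_of_wf W hX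
      simp only [Gen.rootStep_merge, Gen.reach_merge]
      exact (min_le_left _ _).trans (h.trans ((le_max_left _ _).trans (Nat.le_add_right _ _)))

/-- **THE WINDOWS ADD UP TO THE LIFE SPAN PLUS THE SURPLUS**: for a well-formed genealogy,
`Σ_{e ∈ events G} W e = (reach G − rootStep G) + windowSurplus W G`.  By induction on the ledger: a renewal at `h` adds a
window `W e` reaching `h + 1 + W e` and double-covers `reach − (h+1)` steps; a merger adds the merger window beyond the
later reach while the two partners' covers overlap on `[max rootStep, min reach)`. [folklore] -/
theorem sum_windows_eq (W : ε → ℕ) : ∀ {G : Gen ε}, G.WF W →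
    ∑ e ∈ G.events, W e = (G.reach W - G.rootStep) + windowSurplus W G
  | Gen.born b j, _ => by simp
  | Gen.renew G e h, hW => by
      have hW' := hW
      simp only [Gen.WF] at hW'
      obtain ⟨hG, he, hjh, hr⟩ := hW'
      have ih := sum_windows_eq W hG
      have hjr := rootStep_le_reach_of_wf W hG
      rw [Gen.events_renew, Finset.sum_insert he, ih]
      simp only [Gen.reach_renew, Gen.rootStep_renew, windowSurplus_renew]
      omega
  | Gen.merge X Y e, hW => by
      have hW' := hW
      simp only [Gen.WF] at hW'
      obtain ⟨hX, hY, heX, heY, hdis, h1, h2⟩ := hW'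
      have ihX := sum_windows_eq W hX
      have ihY := sum_windows_eq W hY
      have hxr := rootStep_le_reach_of_wf W hX
      have hyr := rootStep_le_reach_of_wf W hY
      have hmem : e ∉ X.events ∪ Y.events := by simp [heX, heY]
      rw [Gen.events_merge, Finset.sum_insert hmem, Finset.sum_union hdis, ihX, ihY]
      simp only [Gen.reach_merge, Gen.rootStep_merge, windowSurplus_merge]
      omega

/-- **PENDING ⇒ SPAN + SURPLUS ≤ WINDOWS**: a well-formed genealogy still pending at `K` (`K < reach`) has
`(K + 1 − rootStep) + windowSurplus ≤ Σ_{events} W`. [folklore] -/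
theorem span_add_windowSurplus_le (W : ε → ℕ) {G : Gen ε} (hW : G.WF W) {K : ℕ} (hK : K < G.reach W) :
    (K + 1 - G.rootStep) + windowSurplus W G ≤ ∑ e ∈ G.events, W e := by
  rw [sum_windows_eq W hW]
  omega

end Surplus

/-! ## §2 The telescoped shape: what the records count needs of a price, and how a multiplicity enters it -/

section Telescoped

variable {ε : Type*}

/-- **THE TELESCOPED RECORD SUM** (second half of `T4PersistentHistoryCount.pairedRecordSum_le`): if every record `Q` of
the universe `E` is priced by `y Q ≤ ρ · e^{−κ₁ (K + 1 − j)} · ∏_{e ∈ Q} η e` (`ρ, η ≥ 0`), then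
`Σ_{Q ∈ records} y Q ≤ ρ · e^{−κ₁ (K + 1 − j)} · ∏_{e ∈ E} (1 + η e)` — records counted as subsets of `E`
(`Finset.prod_one_add`).  No sign condition on `κ₁` is needed here. [folklore] -/
theorem telescopedRecordSum_le (W : ε → ℕ) (j K : ℕ) (E : Finset ε) (b : ε) {κ₁ ρ : ℝ} (hρ : 0 ≤ ρ)
    (η : ε → ℝ) (hη : ∀ e ∈ E, 0 ≤ η e) (y : Finset ε → ℝ)
    (hy : ∀ Q ∈ records W j K E b, y Q ≤ ρ * Real.exp (-(κ₁ * ((K + 1 - j : ℕ) : ℝ))) * ∏ e ∈ Q, η e) :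
    ∑ Q ∈ records W j K E b, y Q ≤ ρ * Real.exp (-(κ₁ * ((K + 1 - j : ℕ) : ℝ))) * ∏ e ∈ E, (1 + η e) := by
  have h0 : 0 ≤ ρ * Real.exp (-(κ₁ * ((K + 1 - j : ℕ) : ℝ))) := mul_nonneg hρ (Real.exp_pos _).le
  calc ∑ Q ∈ records W j K E b, y Q
      ≤ ∑ Q ∈ records W j K E b, ρ * Real.exp (-(κ₁ * ((K + 1 - j : ℕ) : ℝ))) * ∏ e ∈ Q, η e :=
        Finset.sum_le_sum hy
    _ ≤ ∑ Q ∈ E.powerset, ρ * Real.exp (-(κ₁ * ((K + 1 - j : ℕ) : ℝ))) * ∏ e ∈ Q, η e :=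
        Finset.sum_le_sum_of_subset_of_nonneg (Finset.filter_subset _ _) fun Q hQ _ =>
          mul_nonneg h0 (Finset.prod_nonneg fun e he => hη e (Finset.mem_powerset.1 hQ he))
    _ = ρ * Real.exp (-(κ₁ * ((K + 1 - j : ℕ) : ℝ))) * ∑ Q ∈ E.powerset, ∏ e ∈ Q, η e := by
        rw [Finset.mul_sum]
    _ = ρ * Real.exp (-(κ₁ * ((K + 1 - j : ℕ) : ℝ))) * ∏ e ∈ E, (1 + η e) := by
        rw [Finset.prod_one_add]

/-- **ONE SLOT'S PRICE IN THE TWO-RATE SHAPE FROM TELESCOPED PRICES** (the conclusion of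
`T4PersistentHistoryCount.slotPrice_le`, verbatim, from the weaker hypothesis): summed over the birth kinds `b ∈ B`
(`Σ ρ ≤ ρ̄`) and the records over an event universe on the steps `(j, K]` with per-step residual entropy `≤ η̄`,
`Σ_b Σ_Q y b Q ≤ ρ̄ e^{−κ₁} σ^{K − j}`, `σ = e^{η̄ − κ₁}`. [folklore] -/
theorem slotPriceT_le [DecidableEq ε] (W : ε → ℕ) {j K : ℕ} (hjK : j ≤ K) (E B : Finset ε) (step : ε → ℕ)
    (hE : ∀ e ∈ E, step e ∈ Ioc j K) {κ₁ ρbar ηbar : ℝ} (ρ : ε → ℝ) (hρ : ∀ b ∈ B, 0 ≤ ρ b)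
    (hρbar : ∑ b ∈ B, ρ b ≤ ρbar) (η : ε → ℝ) (hη : ∀ e ∈ E, 0 ≤ η e)
    (hηbar : ∀ t ∈ Ioc j K, ∑ e ∈ E with step e = t, η e ≤ ηbar) (y : ε → Finset ε → ℝ)
    (hy : ∀ b ∈ B, ∀ Q ∈ records W j K E b,
      y b Q ≤ ρ b * Real.exp (-(κ₁ * ((K + 1 - j : ℕ) : ℝ))) * ∏ e ∈ Q, η e) :
    ∑ b ∈ B, ∑ Q ∈ records W j K E b, y b Q ≤ ρbar * Real.exp (-κ₁) * Real.exp (ηbar - κ₁) ^ (K - j) := by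
  have hP : 0 ≤ ∏ e ∈ E, (1 + η e) := Finset.prod_nonneg fun e he => by linarith [hη e he]
  have h1 : ∑ b ∈ B, ∑ Q ∈ records W j K E b, y b Q ≤
      ρbar * Real.exp (-(κ₁ * ((K + 1 - j : ℕ) : ℝ))) * ∏ e ∈ E, (1 + η e) := by
    calc ∑ b ∈ B, ∑ Q ∈ records W j K E b, y b Q
        ≤ ∑ b ∈ B, ρ b * Real.exp (-(κ₁ * ((K + 1 - j : ℕ) : ℝ))) * ∏ e ∈ E, (1 + η e) :=
          Finset.sum_le_sum fun b hb => telescopedRecordSum_le W j K E b (hρ b hb) η hη (y b) (hy b hb)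
      _ = (∑ b ∈ B, ρ b) * (Real.exp (-(κ₁ * ((K + 1 - j : ℕ) : ℝ))) * ∏ e ∈ E, (1 + η e)) := by
          rw [Finset.sum_mul]; exact Finset.sum_congr rfl fun b _ => by ring
      _ ≤ ρbar * (Real.exp (-(κ₁ * ((K + 1 - j : ℕ) : ℝ))) * ∏ e ∈ E, (1 + η e)) :=
          mul_le_mul_of_nonneg_right hρbar (mul_nonneg (Real.exp_pos _).le hP)
      _ = ρbar * Real.exp (-(κ₁ * ((K + 1 - j : ℕ) : ℝ))) * ∏ e ∈ E, (1 + η e) := by ring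
  have h2 := prod_one_add_le_exp_mul step hE hη hηbar
  have hρbar0 : 0 ≤ ρbar := le_trans (Finset.sum_nonneg hρ) hρbar
  have h0 : 0 ≤ ρbar * Real.exp (-(κ₁ * ((K + 1 - j : ℕ) : ℝ))) := mul_nonneg hρbar0 (Real.exp_pos _).le
  calc ∑ b ∈ B, ∑ Q ∈ records W j K E b, y b Q
      ≤ ρbar * Real.exp (-(κ₁ * ((K + 1 - j : ℕ) : ℝ))) * Real.exp (ηbar * ((K - j : ℕ) : ℝ)) :=
        h1.trans (mul_le_mul_of_nonneg_left h2 h0)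
    _ = ρbar * Real.exp (-κ₁) * Real.exp (ηbar - κ₁) ^ (K - j) := by
        rw [mul_assoc, exp_span_mul_exp_eq hjK, ← mul_assoc]

/-- **A MULTIPLICITY IS PAID BY SURPLUS STEPS**: with `κ₁ ≥ 0`, `0 ≤ Λ′`, `Λ′·e^{−κ₁} ≤ 1` and `n + D ≤ S`,
`Λ′^D · e^{−κ₁ S} ≤ e^{−κ₁ n}` — each of the `D` surplus steps carries an unused credit `e^{−κ₁} ≤ 1/Λ′`. [folklore] -/
theorem mulFactor_le {κ₁ Λ' : ℝ} (hκ : 0 ≤ κ₁) (hΛ0 : 0 ≤ Λ') (hΛ1 : Λ' * Real.exp (-κ₁) ≤ 1) {n D : ℕ} {S : ℝ}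
    (h : (n : ℝ) + D ≤ S) : Λ' ^ D * Real.exp (-(κ₁ * S)) ≤ Real.exp (-(κ₁ * n)) := by
  have h1 : Λ' ^ D * Real.exp (-(κ₁ * D)) ≤ 1 := by
    rw [show -(κ₁ * (D : ℝ)) = (D : ℕ) * (-κ₁) by ring, Real.exp_nat_mul, ← mul_pow]
    exact pow_le_one₀ (mul_nonneg hΛ0 (Real.exp_pos _).le) hΛ1
  have hsplit : -(κ₁ * S) = -(κ₁ * D) + -(κ₁ * (S - D)) := by ring
  calc Λ' ^ D * Real.exp (-(κ₁ * S))
      = Λ' ^ D * Real.exp (-(κ₁ * D)) * Real.exp (-(κ₁ * (S - D))) := by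
        rw [hsplit, Real.exp_add, ← mul_assoc]
    _ ≤ 1 * Real.exp (-(κ₁ * (S - D))) := mul_le_mul_of_nonneg_right h1 (Real.exp_pos _).le
    _ ≤ Real.exp (-(κ₁ * n)) := by
        rw [one_mul]
        exact Real.exp_le_exp.2 (neg_le_neg (mul_le_mul_of_nonneg_left (by linarith) hκ))

/-- **RECORD SHAPE × MULTIPLICITY ⇒ TELESCOPED SHAPE**: if `(n + D) ≤ W b + Σ_{e ∈ Q} W e` (the span `n` plus `D`
surplus steps are covered by the windows), `κ₁ ≥ 0`, `0 ≤ Λ′`, `Λ′ e^{−κ₁} ≤ 1`, `ρ ≥ 0`, `η ≥ 0` on `Q`, then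
`Λ′^D · (ρ e^{−κ₁ W b} ∏_{e ∈ Q} e^{−κ₁ W e} η e) ≤ ρ e^{−κ₁ n} ∏_{e ∈ Q} η e`. [folklore] -/
theorem telescoped_of_mulRecordShape {W : ε → ℕ} {b : ε} {Q : Finset ε} {κ₁ Λ' ρ : ℝ} (hκ : 0 ≤ κ₁) (hΛ0 : 0 ≤ Λ')
    (hΛ1 : Λ' * Real.exp (-κ₁) ≤ 1) (hρ : 0 ≤ ρ) {η : ε → ℝ} (hη : ∀ e ∈ Q, 0 ≤ η e) {n D : ℕ}
    (hD : n + D ≤ W b + ∑ e ∈ Q, W e) :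
    Λ' ^ D * (ρ * Real.exp (-(κ₁ * W b)) * ∏ e ∈ Q, (Real.exp (-(κ₁ * W e)) * η e)) ≤
      ρ * Real.exp (-(κ₁ * (n : ℝ))) * ∏ e ∈ Q, η e := by
  have hη' : 0 ≤ ∏ e ∈ Q, η e := Finset.prod_nonneg hη
  have hS : (n : ℝ) + D ≤ (W b : ℝ) + ∑ e ∈ Q, (W e : ℝ) := by exact_mod_cast hD
  have key := mulFactor_le hκ hΛ0 hΛ1 hS
  have hL : Λ' ^ D * (ρ * Real.exp (-(κ₁ * W b)) * ∏ e ∈ Q, (Real.exp (-(κ₁ * W e)) * η e)) =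
      ρ * (∏ e ∈ Q, η e) * (Λ' ^ D * Real.exp (-(κ₁ * ((W b : ℝ) + ∑ e ∈ Q, (W e : ℝ))))) := by
    rw [Finset.prod_mul_distrib, ← Real.exp_sum]
    have h : -(κ₁ * ((W b : ℝ) + ∑ e ∈ Q, (W e : ℝ))) = -(κ₁ * W b) + ∑ e ∈ Q, -(κ₁ * (W e : ℝ)) := by
      rw [mul_add, Finset.mul_sum, neg_add, ← Finset.sum_neg_distrib]
    rw [h, Real.exp_add]
    ring
  rw [hL]
  calc ρ * (∏ e ∈ Q, η e) * (Λ' ^ D * Real.exp (-(κ₁ * ((W b : ℝ) + ∑ e ∈ Q, (W e : ℝ)))))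
      ≤ ρ * (∏ e ∈ Q, η e) * Real.exp (-(κ₁ * n)) := mul_le_mul_of_nonneg_left key (mul_nonneg hρ hη')
    _ = ρ * Real.exp (-(κ₁ * (n : ℝ))) * ∏ e ∈ Q, η e := by ring

/-- The seam's case `D = 0`, `Λ′ = 1`: a price in the RECORD SHAPE of `T4PersistentHistoryCount.slotPrice_le` over a record
satisfying the span condition is telescoped (`pairedFactor_le` repackaged). [folklore] -/
theorem telescoped_of_recordShape {W : ε → ℕ} {j K : ℕ} {b : ε} {Q : Finset ε} {κ₁ ρ : ℝ} (hκ : 0 ≤ κ₁) (hρ : 0 ≤ ρ)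
    {η : ε → ℝ} (hη : ∀ e ∈ Q, 0 ≤ η e) (hQ : SpanLE W j K b Q) :
    ρ * Real.exp (-(κ₁ * W b)) * ∏ e ∈ Q, (Real.exp (-(κ₁ * W e)) * η e) ≤
      ρ * Real.exp (-(κ₁ * ((K + 1 - j : ℕ) : ℝ))) * ∏ e ∈ Q, η e := by
  have h := telescoped_of_mulRecordShape (Λ' := 1) (n := K + 1 - j) (D := 0) hκ zero_le_one
    (by rw [one_mul]; exact Real.exp_le_one_iff.2 (by linarith)) hρ hη (by simpa [SpanLE] using hQ)
  simpa using h

end Telescoped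

/-! ## §3 Live and old masses from any per-slot two-rate bound -/

section Masses

variable {γ ε : Type*}

/-- **THE LIVE MASS FROM A PER-SLOT BOUND**: cells `#Cell K a ≤ V·Λ^a`, per-slot totals
`Σ_b Σ_Q y j z b Q ≤ C·σ^{K − j}` for every `j ≤ K`, `0 ≤ C`, `0 ≤ σ`, `Λσ < 1` ⇒ `Σ_{liveSlots K} y ≤ C·V/(1 − Λσ)` —
the cell/age sums of `T4LiveStructureGas.liveMass_le`, with the records count abstracted away. [folklore] -/
theorem liveMass_le_of_slotBound (Cell : ℕ → ℕ → Finset γ) {V Λ Cst σ : ℝ} (hV : 0 ≤ V) (hΛ : 0 ≤ Λ)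
    (hCst : 0 ≤ Cst) (hσ : 0 ≤ σ) (hr : Λ * σ < 1) {K : ℕ} (hcell : ∀ a, ((Cell K a).card : ℝ) ≤ V * Λ ^ a)
    (W : ε → ℕ) (E B : ℕ → ℕ → Finset ε) (y : ℕ → γ → ε → Finset ε → ℝ)
    (hX : ∀ j ≤ K, ∀ z ∈ Cell K (K - j),
      ∑ b ∈ B K j, ∑ Q ∈ records W j K (E K j) b, y j z b Q ≤ Cst * σ ^ (K - j)) :
    ∑ s ∈ liveSlots Cell W E B K, slotPrice y s ≤ Cst * V * (1 / (1 - Λ * σ)) := by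
  rw [sum_liveSlots_eq]
  simp only [slotPrice_mk]
  calc ∑ j ∈ range (K + 1), ∑ z ∈ Cell K (K - j), ∑ b ∈ B K j, ∑ Q ∈ records W j K (E K j) b, y j z b Q
      ≤ ∑ j ∈ range (K + 1), ∑ _z ∈ Cell K (K - j), Cst * σ ^ (K - j) :=
        Finset.sum_le_sum fun j hj => Finset.sum_le_sum fun z hz =>
          hX j (Nat.lt_succ_iff.1 (Finset.mem_range.1 hj)) z hz
    _ ≤ ∑ j ∈ range (K + 1), Cst * V * (Λ * σ) ^ (K - j) := by
        refine Finset.sum_le_sum fun j _ => ?_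
        rw [Finset.sum_const, nsmul_eq_mul]
        calc ((Cell K (K - j)).card : ℝ) * (Cst * σ ^ (K - j))
            ≤ V * Λ ^ (K - j) * (Cst * σ ^ (K - j)) :=
              mul_le_mul_of_nonneg_right (hcell (K - j)) (mul_nonneg hCst (pow_nonneg hσ _))
          _ = Cst * V * (Λ * σ) ^ (K - j) := by rw [mul_pow]; ring
    _ = Cst * V * ∑ j ∈ range (K + 1), (Λ * σ) ^ (K - j) := by rw [Finset.mul_sum]
    _ ≤ Cst * V * (1 / (1 - Λ * σ)) :=
        mul_le_mul_of_nonneg_left (sum_range_succ_pow_sub_le (mul_nonneg hΛ hσ) hr K) (mul_nonneg hCst hV)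

/-- **THE OLD MASS FROM A PER-SLOT BOUND**: per-slot totals `≤ C·σ^{K − j}` for the births `j < j⋆ K ≤ K` ⇒
`Σ_{oldSlots K} y ≤ C·V·(Λσ)^{K − j⋆ K + 1}/(1 − Λσ)` (`T4PersistentHistoryCount.slotBudget_model` by name). [folklore] -/
theorem oldMass_le_of_slotBound (Cell : ℕ → ℕ → Finset γ) {V Λ Cst σ : ℝ} (hV : 0 ≤ V) (hΛ : 0 ≤ Λ)
    (hCst : 0 ≤ Cst) (hσ : 0 ≤ σ) (hr : Λ * σ < 1) {K : ℕ} (hcell : ∀ a, ((Cell K a).card : ℝ) ≤ V * Λ ^ a)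
    (W : ε → ℕ) (E B : ℕ → ℕ → Finset ε) {jstar : ℕ → ℕ} (hj : jstar K ≤ K) (y : ℕ → γ → ε → Finset ε → ℝ)
    (hX : ∀ j < jstar K, ∀ z ∈ Cell K (K - j),
      ∑ b ∈ B K j, ∑ Q ∈ records W j K (E K j) b, y j z b Q ≤ Cst * σ ^ (K - j)) :
    ∑ s ∈ oldSlots Cell W E B jstar K, slotPrice y s ≤ Cst * V * ((Λ * σ) ^ (K - jstar K + 1) / (1 - Λ * σ)) := by
  rw [sum_oldSlots_eq]
  simp only [slotPrice_mk]
  exact slotBudget_model (Cell K) hV hΛ hCst hσ hr hcell hj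
    (fun j z => ∑ b ∈ B K j, ∑ Q ∈ records W j K (E K j) b, y j z b Q) hX

end Masses

/-! ## §4 Composition by name: telescoped prices on the run-indexed live slots ⇒ the term-level weight slot -/

section Run

/-- **REGENERATION READING + TELESCOPED LIVE GAS ⇒ TERM-LEVEL SLOT.**  The renewal member's ABSTRACT
`T4LiveGasToTerms.exists_relWeightBound_of_regeneration_liveGas` with `U K := liveSlots Cell (W K) E B K`,
`O K := oldSlots Cell (W K) E B j⋆ K`, prices `slotPrice (y K)`, the masses of §3 fed by `slotPriceT_le` from prices in the
TELESCOPED shape `y K j z b Q ≤ ρ K b · e^{−κ₁ (K + 1 − j)} · ∏_{e ∈ Q} η K e` (asked from `K₀` on), budgets `Σ_b ρ ≤ ρ̄`,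
per-step residual entropy `≤ η̄`, rate `Λ·e^{η̄ − κ₁} < 1`, matching scales with `c·K ≤ K − j⋆ K`, injective live families
with an old slot, two term-level `Regeneration` runs dominated by `famWeight (slotPrice (y K))`, `0 ≤ C` ⇒
`∃ K₁ ≥ K₀`, the kernel's term-level `RelWeightBound` with the saturated bad set and
`W = 𝟙_{K ≥ K₁} · C · recordsBudget ρ̄ κ₁ V Λ η̄ j⋆` — the SAME budget as `T4RecordPriceSeam.exists_relWeightBound_of_
regeneration_recordsGasRun`, from the weaker price hypothesis. [folklore] -/
theorem exists_relWeightBound_of_regeneration_telescopedGasRun {γ ε κ ι : Type*} [DecidableEq γ] [DecidableEq ε]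
    [DecidableEq κ] {l₀ : ℝ} {K₀ : ℕ} {π : ℕ → ι → κ} {T : ℕ → Finset ι}
    {A A' : ℕ → ℝ → ι → ℝ} {Bad' : ℕ → ℝ → Finset κ} {dead dead' : ℕ → ℝ → ι → ℝ} {F Rf F' Rf' : ℕ → κ → ℝ}
    {nlow nup mlow mup : ℕ → ℝ → ℝ} {C : ℝ}
    (Cell : ℕ → ℕ → Finset γ) {V Λ : ℝ} (hV : 0 ≤ V) (hΛ : 0 < Λ)
    (hcell : ∀ K a, ((Cell K a).card : ℝ) ≤ V * Λ ^ a) (W : ℕ → ε → ℕ) (step : ε → ℕ) (E B : ℕ → ℕ → Finset ε)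
    (hE : ∀ K j, ∀ e ∈ E K j, step e ∈ Ioc j K) {κ₁ ρbar ηbar : ℝ} (ρ : ℕ → ε → ℝ)
    (hρ : ∀ K j, ∀ b ∈ B K j, 0 ≤ ρ K b) (hρbar : ∀ K j, ∑ b ∈ B K j, ρ K b ≤ ρbar) (η : ℕ → ε → ℝ)
    (hη : ∀ K j, ∀ e ∈ E K j, 0 ≤ η K e)
    (hηbar : ∀ K j, ∀ t ∈ Ioc j K, ∑ e ∈ E K j with step e = t, η K e ≤ ηbar)
    (hr : Λ * Real.exp (ηbar - κ₁) < 1) (jstar : ℕ → ℕ) (hj : ∀ K, jstar K ≤ K) {c : ℝ} (hc : 0 < c)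
    (hfrac : ∀ K : ℕ, c * K ≤ ((K - jstar K : ℕ) : ℝ)) (y : ℕ → ℕ → γ → ε → Finset ε → ℝ)
    (hy0 : ∀ K, ∀ j ≤ K, ∀ z ∈ Cell K (K - j), ∀ b ∈ B K j, ∀ Q ∈ records (W K) j K (E K j) b, 0 ≤ y K j z b Q)
    (hyT : ∀ K, K₀ ≤ K → ∀ j ≤ K, ∀ z ∈ Cell K (K - j), ∀ b ∈ B K j, ∀ Q ∈ records (W K) j K (E K j) b,
      y K j z b Q ≤ ρ K b * Real.exp (-(κ₁ * ((K + 1 - j : ℕ) : ℝ))) * ∏ e ∈ Q, η K e)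
    (str : ℕ → κ → Finset (Slot γ ε))
    (hinj : ∀ K t, |t| ≤ l₀ → K₀ ≤ K → Set.InjOn (str K) (Bad' K t))
    (hstr : ∀ K t, |t| ≤ l₀ → K₀ ≤ K → ∀ c ∈ Bad' K t,
      str K c ⊆ liveSlots Cell (W K) E B K ∧ ∃ o ∈ oldSlots Cell (W K) E B jstar K, o ∈ str K c)
    (hA : Regeneration l₀ π T A Bad' dead F Rf nlow nup C K₀)
    (hA' : Regeneration l₀ π T A' Bad' dead' F' Rf' mlow mup C K₀)
    (hF : ∀ K t, |t| ≤ l₀ → K₀ ≤ K → ∀ c ∈ Bad' K t, F K c * Rf K c ≤ famWeight (slotPrice (y K)) (str K c))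
    (hF' : ∀ K t, |t| ≤ l₀ → K₀ ≤ K → ∀ c ∈ Bad' K t, F' K c * Rf' K c ≤ famWeight (slotPrice (y K)) (str K c))
    (hC : 0 ≤ C) :
    ∃ K₁, K₀ ≤ K₁ ∧ RelWeightBound l₀ T A A' (fun K t => if K₁ ≤ K then badOfClass π T Bad' K t else ∅)
      (Set.indicator {K | K₁ ≤ K} (fun K => C * recordsBudget ρbar κ₁ V Λ ηbar jstar K)) := by
  have hρbar0 : 0 ≤ ρbar := le_trans (Finset.sum_nonneg (hρ 0 0)) (hρbar 0 0)
  have hσ0 : 0 ≤ Real.exp (ηbar - κ₁) := (Real.exp_pos _).le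
  have hCst : 0 ≤ ρbar * Real.exp (-κ₁) := mul_nonneg hρbar0 (Real.exp_pos _).le
  -- prices are nonnegative on the live slots
  have hq : ∀ K, ∀ s ∈ liveSlots Cell (W K) E B K, 0 ≤ slotPrice (y K) s := by
    intro K s hs
    obtain ⟨j, z, b, Q⟩ := s
    simp only [liveSlots, Finset.mem_sigma, Finset.mem_range] at hs
    exact hy0 K j (Nat.lt_succ_iff.1 hs.1) z hs.2.1 b hs.2.2.1 Q hs.2.2.2
  -- the per-slot two-rate bound from telescoped prices
  have hslot : ∀ K, K₀ ≤ K → ∀ j ≤ K, ∀ z ∈ Cell K (K - j),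
      ∑ b ∈ B K j, ∑ Q ∈ records (W K) j K (E K j) b, y K j z b Q ≤
        ρbar * Real.exp (-κ₁) * Real.exp (ηbar - κ₁) ^ (K - j) :=
    fun K hK j hjK z hz => slotPriceT_le (W K) hjK (E K j) (B K j) step (hE K j) (ρ K) (hρ K j) (hρbar K j) (η K)
      (hη K j) (hηbar K j) (y K j z) (hyT K hK j hjK z hz)
  have hmold0 : ∀ K, 0 ≤ ρbar * Real.exp (-κ₁) * V *
      ((Λ * Real.exp (ηbar - κ₁)) ^ (K - jstar K + 1) / (1 - Λ * Real.exp (ηbar - κ₁))) := by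
    intro K
    have hσ0' : 0 ≤ Λ * Real.exp (ηbar - κ₁) := mul_nonneg hΛ.le hσ0
    have h1 : 0 < 1 - Λ * Real.exp (ηbar - κ₁) := by linarith
    exact mul_nonneg (mul_nonneg hCst hV) (div_nonneg (pow_nonneg hσ0' _) h1.le)
  exact exists_relWeightBound_of_regeneration_liveGas (fun K => liveSlots Cell (W K) E B K)
    (fun K => oldSlots Cell (W K) E B jstar K)
    (fun K => oldSlots_subset_liveSlots Cell (W K) E B (hj K)) (fun K => slotPrice (y K)) hq str hinj hstr
    (mold := fun K => ρbar * Real.exp (-κ₁) * V *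
      ((Λ * Real.exp (ηbar - κ₁)) ^ (K - jstar K + 1) / (1 - Λ * Real.exp (ηbar - κ₁))))
    (mlive := fun K => ρbar * Real.exp (-κ₁) * V * (1 / (1 - Λ * Real.exp (ηbar - κ₁))))
    hmold0
    (fun K hK => oldMass_le_of_slotBound Cell hV hΛ.le hCst hσ0 hr (hcell K) (W K) E B (hj K) (y K)
      fun j hjlt z hz => hslot K hK j ((le_of_lt hjlt).trans (hj K)) z hz)
    (fun K hK => liveMass_le_of_slotBound Cell hV hΛ.le hCst hσ0 hr (hcell K) (W K) E B (y K) (hslot K hK))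
    (summable_recordsBudget hρbar0 hV hΛ hr hc hfrac) hA hA' hF hF' hC

end Run

/-! ## §5 The multiplicity-tolerant seam on the dictionary -/

section SeamM

variable {C : T4PrintedShapeBanking.Consts} {K : ℕ} {R : ℕ → ℕ} {g : ℕ → ℝ}

/-- **CONSISTENT ⇒ PARTNER AGES ≤ SURPLUS**: in a consistent genealogy the merger step `e.step` satisfies
`max rootStep ≤ e.step < min reach`, so each merger's partner age plus one is at most the number of doubly covered steps.
[folklore] -/
theorem partnerAges_le_windowSurplus :
    ∀ {G : Gen PEv}, Consistent C K R G → partnerAges PEv.step G ≤ windowSurplus (dictW R C.n₁) G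
  | Gen.born b j, _ => by simp
  | Gen.renew G e h, hc => by
      simp only [Consistent] at hc
      have ih := partnerAges_le_windowSurplus hc.1
      simp only [partnerAges_renew, windowSurplus_renew]
      omega
  | Gen.merge X Y e, hc => by
      simp only [Consistent] at hc
      obtain ⟨hX, hY, -, h1, h2, h3, h4, -⟩ := hc
      have ihX := partnerAges_le_windowSurplus hX
      have ihY := partnerAges_le_windowSurplus hY
      simp only [partnerAges_merge, windowSurplus_merge]
      omega

/-- **PENDING ⇒ SPAN + PARTNER AGES ≤ WINDOWS** on the dictionary: a consistent well-formed genealogy pending at `K` has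
`(K + 1 − rootStep) + partnerAges ≤ Σ_{events} dictW`. [folklore] -/
theorem span_add_partnerAges_le {G : Gen PEv} (hc : Consistent C K R G) (hW : G.WF (dictW R C.n₁))
    (hK : K < G.reach (dictW R C.n₁)) :
    (K + 1 - G.rootStep) + partnerAges PEv.step G ≤ ∑ e ∈ G.events, dictW R C.n₁ e := by
  have h1 := span_add_windowSurplus_le (dictW R C.n₁) hW hK
  have h2 := partnerAges_le_windowSurplus hc
  omega

/-- **THE MULTIPLICITY-TOLERANT SEAM, ONE SLOT.**  If the printed shapes inhabit `Banking` at cutoff `K` along the run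
`(R, g)`, `0 ≤ κ₁`, `0 ≤ Λ′` and `Λ′·e^{−κ₁} ≤ 1`, then a price `y` LABELLED WITH MULTIPLICITY at the slot `(j, b, Q)` —
either `y ≤ 0`, or `y` is at most `Λ′^{partnerAges G}` times the raw factor `e^{−credits}·e^{+lifeCost}` of SOME consistent
well-formed genealogy `G` born at `j`, pending at `K`, with root `b` and record `Q` (the displayed binder `hlabM`) — is
TELESCOPED: `y ≤ ρ b · e^{−κ₁ (K + 1 − j)} · ∏_{e ∈ Q} η e`, `ρ = rho C g`, `η = eta C`, `κ₁ = C.κ₁`.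
`T4RecordPriceSeam.price_le_shape` + §1 + `telescoped_of_mulRecordShape`. [folklore] -/
theorem telescoped_of_labelM (hκ : 0 ≤ C.κ₁)
    (hBk : Banking (Consistent C K R) (dictW R C.n₁) (cost C K R) (credit C g)
      (fun e => C.κ₁ * ((dictW R C.n₁ e : ℕ) : ℝ) + Emarg C e) (reserve C g) (extn C K R))
    {Λ' : ℝ} (hΛ0 : 0 ≤ Λ') (hΛ1 : Λ' * Real.exp (-C.κ₁) ≤ 1) {y : ℝ} {j : ℕ} {b : PEv} {Q : Finset PEv}
    (hlabM : y ≤ 0 ∨ ∃ G : Gen PEv, Consistent C K R G ∧ G.WF (dictW R C.n₁) ∧ G.rootStep = j ∧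
      K < G.reach (dictW R C.n₁) ∧ G.root = b ∧ G.events.erase G.root = Q ∧
      y ≤ Λ' ^ partnerAges PEv.step G *
        (Real.exp (-credits (credit C g) G) * Real.exp (lifeCost (dictW R C.n₁) (cost C K R) G))) :
    y ≤ rho C g b * Real.exp (-(C.κ₁ * ((K + 1 - j : ℕ) : ℝ))) * ∏ e ∈ Q, eta C e := by
  rcases hlabM with h | ⟨G, hc, hW, hj, hK, hb, hQ, hy⟩
  · exact h.trans (mul_pos (mul_pos (rho_pos C g b) (Real.exp_pos _))
      (Finset.prod_pos fun e _ => eta_pos C e)).le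
  · have hshape := price_le_shape hBk (Or.inr ⟨G, hc, hW, hb, hQ, le_rfl⟩)
    have hspan : (K + 1 - j) + partnerAges PEv.step G ≤ dictW R C.n₁ b + ∑ e ∈ Q, dictW R C.n₁ e := by
      have h := span_add_partnerAges_le hc hW hK
      rw [hj, ← Finset.add_sum_erase G.events (dictW R C.n₁) (Gen.root_mem G), hQ, hb] at h
      exact h
    calc y ≤ Λ' ^ partnerAges PEv.step G *
          (Real.exp (-credits (credit C g) G) * Real.exp (lifeCost (dictW R C.n₁) (cost C K R) G)) := hy
      _ ≤ Λ' ^ partnerAges PEv.step G * (rho C g b * Real.exp (-(C.κ₁ * dictW R C.n₁ b)) *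
          ∏ e ∈ Q, (Real.exp (-(C.κ₁ * dictW R C.n₁ e)) * eta C e)) :=
          mul_le_mul_of_nonneg_left hshape (pow_nonneg hΛ0 _)
      _ ≤ rho C g b * Real.exp (-(C.κ₁ * ((K + 1 - j : ℕ) : ℝ))) * ∏ e ∈ Q, eta C e :=
          telescoped_of_mulRecordShape hκ hΛ0 hΛ1 (rho_pos C g b).le (fun e _ => (eta_pos C e).le) hspan

/-- **THE MULTIPLICITY-TOLERANT SEAM, ONE CUTOFF** = the binder `hyT K` of §4 on the dictionary: prices `y j z b Q` on the
live slots of cutoff `K` labelled with multiplicity are telescoped at every live slot. [folklore] -/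
theorem telescopedShape_of_bankingM {γ : Type*} (hκ : 0 ≤ C.κ₁)
    (hBk : Banking (Consistent C K R) (dictW R C.n₁) (cost C K R) (credit C g)
      (fun e => C.κ₁ * ((dictW R C.n₁ e : ℕ) : ℝ) + Emarg C e) (reserve C g) (extn C K R))
    {Λ' : ℝ} (hΛ0 : 0 ≤ Λ') (hΛ1 : Λ' * Real.exp (-C.κ₁) ≤ 1)
    (Cell : ℕ → ℕ → Finset γ) (E B : ℕ → ℕ → Finset PEv) (y : ℕ → γ → PEv → Finset PEv → ℝ)
    (hlabM : ∀ j ≤ K, ∀ z ∈ Cell K (K - j), ∀ b ∈ B K j, ∀ Q ∈ records (dictW R C.n₁) j K (E K j) b,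
      y j z b Q ≤ 0 ∨ ∃ G : Gen PEv, Consistent C K R G ∧ G.WF (dictW R C.n₁) ∧ G.rootStep = j ∧
        K < G.reach (dictW R C.n₁) ∧ G.root = b ∧ G.events.erase G.root = Q ∧
        y j z b Q ≤ Λ' ^ partnerAges PEv.step G *
          (Real.exp (-credits (credit C g) G) * Real.exp (lifeCost (dictW R C.n₁) (cost C K R) G))) :
    ∀ j ≤ K, ∀ z ∈ Cell K (K - j), ∀ b ∈ B K j, ∀ Q ∈ records (dictW R C.n₁) j K (E K j) b,
      y j z b Q ≤ rho C g b * Real.exp (-(C.κ₁ * ((K + 1 - j : ℕ) : ℝ))) * ∏ e ∈ Q, eta C e :=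
  fun j hj z hz b hb Q hQ => telescoped_of_labelM hκ hBk hΛ0 hΛ1 (hlabM j hj z hz b hb Q hQ)

end SeamM

/-! ## §6 End to end with multiplicity: typed flow + infrared smallness + prices labelled with multiplicity +
regeneration runs ⇒ `RelWeightBound`, same rate, same budget -/

section EndToEnd

variable {γ κ ι : Type*} [DecidableEq γ] [DecidableEq κ] {l₀ : ℝ} {K₀ : ℕ} {π : ℕ → ι → κ} {T : ℕ → Finset ι}
  {A A' : ℕ → ℝ → ι → ℝ} {Bad' : ℕ → ℝ → Finset κ} {dead dead' : ℕ → ℝ → ι → ℝ} {F Rf F' Rf' : ℕ → κ → ℝ}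
  {nlow nup mlow mup : ℕ → ℝ → ℝ} {Cn : ℝ}

/-- **`Banking` ALONG A FAMILY OF RUNS + PRICES LABELLED WITH MULTIPLICITY + THE TELESCOPED GAS ⇒ THE WEIGHT SLOT.**
`T4RecordPriceSeam.exists_relWeightBound_of_banking` VERBATIM except: the labelling binder is `hlabM` (genealogy born at
`j`, pending at `K`, price at most `Λ′^{partnerAges}` × raw factor) and the two binders `0 ≤ Λ′`, `Λ′·e^{−C.κ₁} ≤ 1` are
added.  Same budgets `ρ̄`, `η̄`, same rate `Λ·e^{η̄ − C.κ₁} < 1`, same conclusion with `recordsBudget ρ̄ C.κ₁ V Λ η̄ j⋆`.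
§5 per cutoff, then §4. [folklore] -/
theorem exists_relWeightBound_of_bankingM {C : T4PrintedShapeBanking.Consts} (hκ : 0 ≤ C.κ₁) (R : ℕ → ℕ → ℕ)
    (g : ℕ → ℕ → ℝ)
    (hBk : ∀ K, K₀ ≤ K → Banking (Consistent C K (R K)) (dictW (R K) C.n₁) (cost C K (R K)) (credit C (g K))
      (fun e => C.κ₁ * ((dictW (R K) C.n₁ e : ℕ) : ℝ) + Emarg C e) (reserve C (g K)) (extn C K (R K)))
    (Cell : ℕ → ℕ → Finset γ) {V Λ : ℝ} (hV : 0 ≤ V) (hΛ : 0 < Λ)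
    (hcell : ∀ K a, ((Cell K a).card : ℝ) ≤ V * Λ ^ a) (E B : ℕ → ℕ → Finset PEv)
    (hE : ∀ K j, ∀ e ∈ E K j, PEv.step e ∈ Ioc j K) {ρbar ηbar : ℝ}
    (hρbar : ∀ K j, ∑ b ∈ B K j, rho C (g K) b ≤ ρbar)
    (hηbar : ∀ K j, ∀ t ∈ Ioc j K, ∑ e ∈ E K j with PEv.step e = t, eta C e ≤ ηbar)
    (hr : Λ * Real.exp (ηbar - C.κ₁) < 1) {Λ' : ℝ} (hΛ0 : 0 ≤ Λ') (hΛ1 : Λ' * Real.exp (-C.κ₁) ≤ 1)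
    (jstar : ℕ → ℕ) (hj : ∀ K, jstar K ≤ K) {c : ℝ} (hc : 0 < c)
    (hfrac : ∀ K : ℕ, c * K ≤ ((K - jstar K : ℕ) : ℝ)) (y : ℕ → ℕ → γ → PEv → Finset PEv → ℝ)
    (hy0 : ∀ K, ∀ j ≤ K, ∀ z ∈ Cell K (K - j), ∀ b ∈ B K j,
      ∀ Q ∈ records (dictW (R K) C.n₁) j K (E K j) b, 0 ≤ y K j z b Q)
    (hlabM : ∀ K, K₀ ≤ K → ∀ j ≤ K, ∀ z ∈ Cell K (K - j), ∀ b ∈ B K j,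
      ∀ Q ∈ records (dictW (R K) C.n₁) j K (E K j) b,
      y K j z b Q ≤ 0 ∨ ∃ G : Gen PEv, Consistent C K (R K) G ∧ G.WF (dictW (R K) C.n₁) ∧ G.rootStep = j ∧
        K < G.reach (dictW (R K) C.n₁) ∧ G.root = b ∧ G.events.erase G.root = Q ∧
        y K j z b Q ≤ Λ' ^ partnerAges PEv.step G * (Real.exp (-credits (credit C (g K)) G) *
          Real.exp (lifeCost (dictW (R K) C.n₁) (cost C K (R K)) G)))
    (str : ℕ → κ → Finset (Slot γ PEv))
    (hinj : ∀ K t, |t| ≤ l₀ → K₀ ≤ K → Set.InjOn (str K) (Bad' K t))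
    (hstr : ∀ K t, |t| ≤ l₀ → K₀ ≤ K → ∀ c ∈ Bad' K t,
      str K c ⊆ liveSlots Cell (dictW (R K) C.n₁) E B K ∧
        ∃ o ∈ oldSlots Cell (dictW (R K) C.n₁) E B jstar K, o ∈ str K c)
    (hA : Regeneration l₀ π T A Bad' dead F Rf nlow nup Cn K₀)
    (hA' : Regeneration l₀ π T A' Bad' dead' F' Rf' mlow mup Cn K₀)
    (hF : ∀ K t, |t| ≤ l₀ → K₀ ≤ K → ∀ c ∈ Bad' K t, F K c * Rf K c ≤ famWeight (slotPrice (y K)) (str K c))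
    (hF' : ∀ K t, |t| ≤ l₀ → K₀ ≤ K → ∀ c ∈ Bad' K t, F' K c * Rf' K c ≤ famWeight (slotPrice (y K)) (str K c))
    (hCn : 0 ≤ Cn) :
    ∃ K₁, K₀ ≤ K₁ ∧ RelWeightBound l₀ T A A' (fun K t => if K₁ ≤ K then badOfClass π T Bad' K t else ∅)
      (Set.indicator {K | K₁ ≤ K} (fun K => Cn * recordsBudget ρbar C.κ₁ V Λ ηbar jstar K)) :=
  exists_relWeightBound_of_regeneration_telescopedGasRun Cell hV hΛ hcell (fun K => dictW (R K) C.n₁) PEv.step E B hE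
    (fun K => rho C (g K)) (fun K _ b _ => (rho_pos C (g K) b).le) hρbar (fun _ => eta C)
    (fun _ _ e _ => (eta_pos C e).le) hηbar hr jstar hj hc hfrac y hy0
    (fun K hK => telescopedShape_of_bankingM hκ (hBk K hK) hΛ0 hΛ1 Cell E B (y K) (hlabM K hK))
    str hinj hstr hA hA' hF hF' hCn

/-- **END TO END WITH MULTIPLICITY — ONE INFRARED THRESHOLD, THEN THE WEIGHT SLOT.**
`T4RecordPriceSeam.exists_irThreshold_relWeightBound` VERBATIM except: the labelling binder is `hlabM` (multiplicity
`Λ′^{partnerAges}`) and the binders `0 ≤ Λ′`, `Λ′·e^{−C.κ₁} ≤ 1` are added after the rate condition.  For valid symbolic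
constants with `a, A₀ > 0`, `L ≥ 1`, `β₀ ≥ 0`, `r(q′+1) < p₀` there is ONE number `x₀` (constants only;
`T4PrintedShapeBanking.exists_irThreshold`) such that for EVERY family of runs `(R K, g K, β′ K)_K` obeying typed (2.7),
(2.9), (2.5), `1 ≤ log g_{K,s}⁻²` and `x₀ ≤ log g_{K,K}⁻²` from `K₀` on, and for every remaining datum, `∃ K₁ ≥ K₀` with
the kernel's term-level `RelWeightBound` — at the SAME rate `Λ·e^{η̄ − C.κ₁} < 1` and the SAME budget as without
multiplicity.  The count member's chain as ONE statement; its binders are the census of what is not kernel. [folklore] -/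
theorem exists_irThreshold_relWeightBoundM (C : T4PrintedShapeBanking.Consts) (hC : C.Valid) (ha : 0 < C.a)
    (hA₀ : 0 < C.A₀) {L r : ℕ} (hL : 1 ≤ L) {β₀ : ℝ} (hβ : 0 ≤ β₀) (hrq : r * (C.q' + 1) < C.p₀)
    (Cell : ℕ → ℕ → Finset γ) {V Λ : ℝ} (hV : 0 ≤ V) (hΛ : 0 < Λ)
    (hcell : ∀ K a, ((Cell K a).card : ℝ) ≤ V * Λ ^ a) (E B : ℕ → ℕ → Finset PEv)
    (hE : ∀ K j, ∀ e ∈ E K j, PEv.step e ∈ Ioc j K) (jstar : ℕ → ℕ) (hj : ∀ K, jstar K ≤ K) {c : ℝ} (hc : 0 < c)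
    (hfrac : ∀ K : ℕ, c * K ≤ ((K - jstar K : ℕ) : ℝ))
    (hA : Regeneration l₀ π T A Bad' dead F Rf nlow nup Cn K₀)
    (hA' : Regeneration l₀ π T A' Bad' dead' F' Rf' mlow mup Cn K₀) (hCn : 0 ≤ Cn) :
    ∃ x₀ : ℝ, ∀ (R : ℕ → ℕ → ℕ) (g : ℕ → ℕ → ℝ) (β' : ℕ → ℝ),
      (∀ K, K₀ ≤ K → B14.FlowIneq27 (g K) (β' K) β₀ C.p₀ K) →
      (∀ K, K₀ ≤ K → B14FlowStep.FlowIneq29 (R K) (g K) L (β' K) β₀ K) →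
      (∀ K, K₀ ≤ K → ∀ s, s ≤ K → B14.IsRj L r (g K s) (R K s)) →
      (∀ K, K₀ ≤ K → ∀ s, s ≤ K → 1 ≤ Real.log ((g K s) ^ 2)⁻¹) →
      (∀ K, K₀ ≤ K → x₀ ≤ Real.log ((g K K) ^ 2)⁻¹) →
      ∀ {ρbar ηbar : ℝ}, (∀ K j, ∑ b ∈ B K j, rho C (g K) b ≤ ρbar) →
      (∀ K j, ∀ t ∈ Ioc j K, ∑ e ∈ E K j with PEv.step e = t, eta C e ≤ ηbar) →
      Λ * Real.exp (ηbar - C.κ₁) < 1 →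
      ∀ {Λ' : ℝ}, 0 ≤ Λ' → Λ' * Real.exp (-C.κ₁) ≤ 1 →
      ∀ (y : ℕ → ℕ → γ → PEv → Finset PEv → ℝ),
      (∀ K, ∀ j ≤ K, ∀ z ∈ Cell K (K - j), ∀ b ∈ B K j,
        ∀ Q ∈ records (dictW (R K) C.n₁) j K (E K j) b, 0 ≤ y K j z b Q) →
      (∀ K, K₀ ≤ K → ∀ j ≤ K, ∀ z ∈ Cell K (K - j), ∀ b ∈ B K j,
        ∀ Q ∈ records (dictW (R K) C.n₁) j K (E K j) b,
        y K j z b Q ≤ 0 ∨ ∃ G : Gen PEv, Consistent C K (R K) G ∧ G.WF (dictW (R K) C.n₁) ∧ G.rootStep = j ∧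
          K < G.reach (dictW (R K) C.n₁) ∧ G.root = b ∧ G.events.erase G.root = Q ∧
          y K j z b Q ≤ Λ' ^ partnerAges PEv.step G * (Real.exp (-credits (credit C (g K)) G) *
            Real.exp (lifeCost (dictW (R K) C.n₁) (cost C K (R K)) G))) →
      ∀ (str : ℕ → κ → Finset (Slot γ PEv)),
      (∀ K t, |t| ≤ l₀ → K₀ ≤ K → Set.InjOn (str K) (Bad' K t)) →
      (∀ K t, |t| ≤ l₀ → K₀ ≤ K → ∀ c ∈ Bad' K t,
        str K c ⊆ liveSlots Cell (dictW (R K) C.n₁) E B K ∧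
          ∃ o ∈ oldSlots Cell (dictW (R K) C.n₁) E B jstar K, o ∈ str K c) →
      (∀ K t, |t| ≤ l₀ → K₀ ≤ K → ∀ c ∈ Bad' K t, F K c * Rf K c ≤ famWeight (slotPrice (y K)) (str K c)) →
      (∀ K t, |t| ≤ l₀ → K₀ ≤ K → ∀ c ∈ Bad' K t, F' K c * Rf' K c ≤ famWeight (slotPrice (y K)) (str K c)) →
      ∃ K₁, K₀ ≤ K₁ ∧ RelWeightBound l₀ T A A' (fun K t => if K₁ ≤ K then badOfClass π T Bad' K t else ∅)
        (Set.indicator {K | K₁ ≤ K} (fun K => Cn * recordsBudget ρbar C.κ₁ V Λ ηbar jstar K)) := by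
  obtain ⟨x₀, hx₀⟩ := exists_irThreshold C hC ha hA₀ hL hβ hrq
  refine ⟨x₀, ?_⟩
  intro R g β' h27 h29 hR hx1 hir ρbar ηbar hρbar hηbar hr Λ' hΛ0 hΛ1 y hy0 hlabM str hinj hstr hF hF'
  exact exists_relWeightBound_of_bankingM hC.κ₁_nonneg R g
    (fun K hK => hx₀ K (R K) (g K) (β' K) (h27 K hK) (h29 K hK) (hR K hK) (hx1 K hK) (hir K hK))
    Cell hV hΛ hcell E B hE hρbar hηbar hr hΛ0 hΛ1 jstar hj hc hfrac y hy0 hlabM str hinj hstr hA hA' hF hF' hCn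

end EndToEnd

/-! ## §7 Sanity: surplus and partner ages on the cross-read's merged genealogy; `hlabM` inhabited on it -/

section Sanity

open XreadC4

/-- On the cross-read's merged genealogy `Z₀ = merge (born (0,0,0) 0) (born (2,0,0) 2) (3,2,0)` (partners born at
steps 0 and 2, merged at step 3): the later partner's age at the merger plus one is `3 + 1 − 2 = 2` (decided).
[folklore] -/
example : partnerAges PEv.step Z₀ = 2 := by decide

/-- … its window surplus on the table `R ≡ 2`, `n₁ = 1` (windows 4, 4, 3; reaches 4 and 6) is `min 4 6 − max 0 2 = 2`,
[folklore] -/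
example : windowSurplus (dictW (fun _ => 2) C₀.n₁) Z₀ = 2 := by
  simp [windowSurplus, Z₀, X₀, Y₀, C₀, Gen.reach, Gen.rootStep, dictW, PEv.kind, PEv.fat, fatWait]

/-- … and its windows add up to `4 + 4 + 3 = 11 = (9 − 0) + 2` = life span + surplus, as `sum_windows_eq` says
(here checked numerically). [folklore] -/
example : ∑ e ∈ Z₀.events, dictW (fun _ => 2) C₀.n₁ e = 11 ∧ Z₀.reach (dictW (fun _ => 2) C₀.n₁) = 9 ∧
    Z₀.rootStep = 0 := by
  refine ⟨?_, ?_, by decide⟩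
  · rw [sum_windows_eq (dictW (fun _ => 2) C₀.n₁) Z₀_wf]
    simp [windowSurplus, Z₀, X₀, Y₀, C₀, Gen.reach, Gen.rootStep, dictW, PEv.kind, PEv.fat, fatWait]
  · simp [Z₀, X₀, Y₀, C₀, Gen.reach, dictW, PEv.kind, PEv.fat, fatWait]

/-- `Z₀` is consistent at the cutoff `K = 8`, at which it is still pending (`8 < 9 = reach`). [folklore] -/
theorem Z₀_consistent8 : Consistent C₀ 8 (fun _ => 2) Z₀ ∧ 8 < Z₀.reach (dictW (fun _ => 2) C₀.n₁) := by
  constructor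
  · simp [Consistent, Z₀, X₀, Y₀, C₀, Gen.reach, Gen.rootStep, dictW, PEv.kind, PEv.step, PEv.fat, fatWait]
  · simp [Z₀, X₀, Y₀, C₀, Gen.reach, dictW, PEv.kind, PEv.fat, fatWait]

/-- With `Λ′ = 1` and the raw factor itself as the price, the labelled branch of `hlabM` holds for `Z₀` at cutoff `8`
(root `(0,0,0)` born at `0`, record `{(2,0,0), (3,2,0)}`) — so `telescoped_of_labelM` is not vacuous on merged, pending
histories. [folklore] -/
example (g : ℕ → ℝ) :
    (Real.exp (-credits (credit C₀ g) Z₀) * Real.exp (lifeCost (dictW (fun _ => 2) C₀.n₁) (cost C₀ 8 (fun _ => 2)) Z₀)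
        ≤ 0) ∨
      ∃ G : Gen PEv, Consistent C₀ 8 (fun _ => 2) G ∧ G.WF (dictW (fun _ => 2) C₀.n₁) ∧ G.rootStep = 0 ∧
        8 < G.reach (dictW (fun _ => 2) C₀.n₁) ∧ G.root = ((0, 0, 0) : PEv) ∧
        G.events.erase G.root = {((3, 2, 0) : PEv), ((2, 0, 0) : PEv)} ∧
        Real.exp (-credits (credit C₀ g) Z₀) *
            Real.exp (lifeCost (dictW (fun _ => 2) C₀.n₁) (cost C₀ 8 (fun _ => 2)) Z₀) ≤
          (1 : ℝ) ^ partnerAges PEv.step G * (Real.exp (-credits (credit C₀ g) G) *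
            Real.exp (lifeCost (dictW (fun _ => 2) C₀.n₁) (cost C₀ 8 (fun _ => 2)) G)) :=
  Or.inr ⟨Z₀, Z₀_consistent8.1, Z₀_wf, by decide, Z₀_consistent8.2, by decide, by decide, by rw [one_pow, one_mul]⟩

/-- The multiplicity lemma at numbers: two surplus steps pay a multiplicity `Λ′² ≤ e^{2κ₁}` — with `κ₁ = log 3`,
`Λ′ = 3`: `3² · e^{−(log 3)·5} ≤ e^{−(log 3)·3}` (span 3, surplus 2, windows 5). [folklore] -/
example : (3 : ℝ) ^ 2 * Real.exp (-(Real.log 3 * (5 : ℝ))) ≤ Real.exp (-(Real.log 3 * ((3 : ℕ) : ℝ))) :=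
  mulFactor_le (κ₁ := Real.log 3) (Λ' := 3) (n := 3) (D := 2) (S := 5) (Real.log_nonneg (by norm_num))
    (by norm_num) (by rw [Real.exp_neg, Real.exp_log (by norm_num : (0:ℝ) < 3)]; norm_num) (by norm_num)

/-- TIGHTNESS of `mulFactor_le`: ONE MORE factor `Λ′` than there are surplus steps is NOT paid — same numbers, `D = 3`
against `S − n = 2`: `3³ · e^{−(log 3)·5} = 1/9 > 1/27 = e^{−(log 3)·3}`.  (So the exponent `partnerAges ≤ windowSurplus`
of §1/§5 is exactly what the unchanged rate affords; a multiplicity growing faster than `e^{κ₁·surplus}` needs either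
more credit or a smaller `Λ′`, i.e. geometry.) [folklore] -/
example : ¬ ((3 : ℝ) ^ 3 * Real.exp (-(Real.log 3 * (5 : ℝ))) ≤ Real.exp (-(Real.log 3 * ((3 : ℕ) : ℝ)))) := by
  have h5 : Real.exp (-(Real.log 3 * (5 : ℝ))) = ((3 : ℝ) ^ 5)⁻¹ := by
    rw [Real.exp_neg, show Real.log 3 * (5 : ℝ) = (5 : ℕ) * Real.log 3 by push_cast; ring, Real.exp_nat_mul,
      Real.exp_log (by norm_num : (0:ℝ) < 3)]
  have h3 : Real.exp (-(Real.log 3 * ((3 : ℕ) : ℝ))) = ((3 : ℝ) ^ 3)⁻¹ := by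
    rw [Real.exp_neg, show Real.log 3 * ((3 : ℕ) : ℝ) = (3 : ℕ) * Real.log 3 by push_cast; ring, Real.exp_nat_mul,
      Real.exp_log (by norm_num : (0:ℝ) < 3)]
  rw [h5, h3]
  norm_num

end Sanity

end Literature.MathematicalPhysics.QuantumFieldTheory.Balaban1983to89.T4PartnerMultiplicity
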